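import Summits.Ventures.PercRepro.Night2RigidStruct
import Summits.Ventures.PercRepro.Night2LocalSeries

/-!
# PercRepro — the rigid cell: only the pairs lose (night-2, gen 18)

In the rigid cell (`|E ∖ G| = q − 1`, `kColoops = q − 2`, `M` simple) a thin member `B` has `ρ(B ∖ K) = 2`
(`eRk_sdiff_coloops_eq_two`).  If `B ∖ K` has at least three elements, the covering set `B ∪ {z}` has NO other thin
covering preimage (`coverPreimages_thin_eq_singleton`): deleting an element `z′ ∈ B ∖ K` keeps the rank of `B`
(two remaining points of the line and the coloops), so `B ∖ z′ ∪ {z}` has rank `q + 1` and is no member.  Hence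
`L1 (B ∪ {z}) = req B ≤ Φ/(q+1) ≤ capS (B ∪ {z})` and the loss vanishes (**`loss_eq_zero_of_three_le`**) — the
losses of the rigid cell sit at the pairs `|B ∖ K| = 2` only (`proofs/NIGHT-2-g18.md` §7).
-/

namespace PercRepro.Shadow

open Finset PerFlat ThmH

variable {α : Type*} [DecidableEq α] {M : Matroid α} [M.Finite]

/-- In a simple matroid two distinct ground elements have rank `2`. -/
theorem eRk_pair_two_simple_rigid (hs : ∀ e ∈ gr M, ∀ f ∈ gr M, e ≠ f → rkN M {e, f} = 2) {a b : α}
    (ha : a ∈ gr M) (hb : b ∈ gr M) (hab : a ≠ b) : M.eRk (({a, b} : Finset α) : Set α) = 2 := by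
  rw [eRk_eq_rkN, hs a ha b hb hab]; rfl

open scoped Classical in
/-- Rigid cell: deleting an element of `B ∖ K` from a thin member with `|B ∖ K| ≥ 3` keeps its rank. -/
theorem eRk_erase_eq_of_three_le {q : ℕ} {G : Finset α} (hG : G ∈ flatsQ M (q + 1))
    (hd : (gr M \ G).card ≤ q) (hk : kColoops M G + 2 = q)
    (hs : ∀ e ∈ gr M, ∀ f ∈ gr M, e ≠ f → rkN M {e, f} = 2) {B : Finset α} (hB : B ∈ thinMembers M q G)
    (h3 : 3 ≤ (B \ coloops M G).card) {z' : α} (hz' : z' ∈ B \ coloops M G) :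
    M.eRk ((B.erase z' : Finset α) : Set α) = (q : ℕ∞) := by
  have hB' : B ∈ membersIn M (Uq M (q + 2) q) G := (mem_thinMembers.1 hB).1
  have hBU : B ∈ Uq M (q + 2) q := (mem_membersIn.1 hB').1
  have hBG : B ⊆ G := (subset_clF hBU).trans (mem_membersIn.1 hB').2
  have hGg : G ⊆ gr M := (mem_flatsQ.1 hG).1
  have hK := coloops_subset_of_mem_thinMembers hG hd hB
  have hr : M.eRk (B : Set α) = (q : ℕ∞) := (mem_Uq.1 hBU).2.1
  apply le_antisymm
  · rw [← hr]; exact M.eRk_mono (by exact_mod_cast Finset.erase_subset _ _)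
  · -- two other elements a ≠ b of B ∖ K remain
    have h2 : 2 ≤ ((B \ coloops M G).erase z').card := by
      rw [Finset.card_erase_of_mem hz']; omega
    obtain ⟨a, ha, b, hb, hab⟩ := Finset.one_lt_card.1 (by omega : 1 < ((B \ coloops M G).erase z').card)
    rw [Finset.mem_erase, Finset.mem_sdiff] at ha hb
    have hsub : coloops M G ∪ ({a, b} : Finset α) ⊆ B.erase z' := by
      intro x hx
      rw [Finset.mem_union, Finset.mem_insert, Finset.mem_singleton] at hx
      rw [Finset.mem_erase]
      rcases hx with hx | rfl | rfl
      · refine ⟨fun h => ?_, hK hx⟩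
        rw [h] at hx; exact (Finset.mem_sdiff.1 hz').2 hx
      · exact ⟨ha.1, ha.2.1⟩
      · exact ⟨hb.1, hb.2.1⟩
    have hY : ∀ y ∈ coloops M G, y ∈ G ∧ y ∉ clF M (G.erase y) := fun y hy => mem_coloops.1 hy
    have hdisj : Disjoint (coloops M G) ({a, b} : Finset α) := by
      rw [Finset.disjoint_left]
      intro x hx hx'
      rw [Finset.mem_insert, Finset.mem_singleton] at hx'
      rcases hx' with rfl | rfl
      · exact ha.2.2 hx
      · exact hb.2.2 hx
    have hab' : ({a, b} : Finset α) ⊆ G := by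
      intro x hx
      rw [Finset.mem_insert, Finset.mem_singleton] at hx
      rcases hx with rfl | rfl
      · exact hBG ha.2.1
      · exact hBG hb.2.1
    have hrk : M.eRk ((coloops M G ∪ ({a, b} : Finset α) : Finset α) : Set α) = (q : ℕ∞) := by
      rw [eRk_union_coloops hGg (coloops M G) hY hab' hdisj,
        eRk_pair_two_simple_rigid hs (hGg (hBG ha.2.1)) (hGg (hBG hb.2.1)) hab, ← kColoops_eq_card_coloops]
      rw [← hk]; push_cast; rfl
    rw [← hrk]
    exact M.eRk_mono (by exact_mod_cast hsub)

open scoped Classical in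
/-- Rigid cell: the closure of `B ∖ z′` is the closure of `B` (`|B ∖ K| ≥ 3`, `z′ ∈ B ∖ K`). -/
theorem clF_erase_eq_of_three_le {q : ℕ} {G : Finset α} (hG : G ∈ flatsQ M (q + 1))
    (hd : (gr M \ G).card ≤ q) (hk : kColoops M G + 2 = q)
    (hs : ∀ e ∈ gr M, ∀ f ∈ gr M, e ≠ f → rkN M {e, f} = 2) {B : Finset α} (hB : B ∈ thinMembers M q G)
    (h3 : 3 ≤ (B \ coloops M G).card) {z' : α} (hz' : z' ∈ B \ coloops M G) :
    clF M (B.erase z') = clF M B := by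
  have hB' : B ∈ membersIn M (Uq M (q + 2) q) G := (mem_thinMembers.1 hB).1
  have hBU : B ∈ Uq M (q + 2) q := (mem_membersIn.1 hB').1
  obtain ⟨q', rfl⟩ : ∃ q', q = q' + 1 := ⟨q - 1, by omega⟩
  have hF : clF M B ∈ flatsQ M (q' + 1) := clF_mem_flatsQ hBU
  apply flat_eq_of_subset_of_eRk_eq hF (by rw [coe_clF]; exact M.isFlat_closure _)
    (clF_mono (Finset.erase_subset _ _))
  rw [coe_clF, M.eRk_closure_eq]
  exact eRk_erase_eq_of_three_le hG hd hk hs hB h3 hz'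

open scoped Classical in
/-- Rigid cell: `(B ∖ z′) ∪ {z}` is not a bottom set (`z ∈ G ∖ cl B`, `z′ ∈ B ∖ K`, `|B ∖ K| ≥ 3`). -/
theorem insert_erase_notMem_Uq {q : ℕ} {G : Finset α} (hG : G ∈ flatsQ M (q + 1))
    (hd : (gr M \ G).card ≤ q) (hk : kColoops M G + 2 = q)
    (hs : ∀ e ∈ gr M, ∀ f ∈ gr M, e ≠ f → rkN M {e, f} = 2) {B : Finset α} (hB : B ∈ thinMembers M q G)
    (h3 : 3 ≤ (B \ coloops M G).card) {z' : α} (hz' : z' ∈ B \ coloops M G) {z : α}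
    (hz : z ∈ G \ clF M B) : insert z (B.erase z') ∉ Uq M (q + 2) q := by
  intro hmem
  have hGg : G ⊆ gr M := (mem_flatsQ.1 hG).1
  have hzE : z ∈ M.E \ M.closure ((B.erase z' : Finset α) : Set α) := by
    refine ⟨by rw [← coe_gr]; exact_mod_cast hGg (Finset.mem_sdiff.1 hz).1, ?_⟩
    rw [← coe_clF, clF_erase_eq_of_three_le hG hd hk hs hB h3 hz']
    exact_mod_cast (Finset.mem_sdiff.1 hz).2
  have h1 : M.eRk ((insert z (B.erase z') : Finset α) : Set α) =
      M.eRk ((B.erase z' : Finset α) : Set α) + 1 := by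
    rw [Finset.coe_insert]; exact Matroid.eRk_insert_eq_add_one hzE
  rw [eRk_erase_eq_of_three_le hG hd hk hs hB h3 hz', (mem_Uq.1 hmem).2.1] at h1
  have : q = q + 1 := by exact_mod_cast h1
  omega

open scoped Classical in
/-- Rigid cell: the only thin covering preimage of `B ∪ {z}` is `B` itself when `|B ∖ K| ≥ 3`. -/
theorem coverPreimages_thin_eq_singleton {q : ℕ} {G : Finset α} (hG : G ∈ flatsQ M (q + 1))
    (hd : (gr M \ G).card ≤ q) (hk : kColoops M G + 2 = q)
    (hs : ∀ e ∈ gr M, ∀ f ∈ gr M, e ≠ f → rkN M {e, f} = 2) {B : Finset α} (hB : B ∈ thinMembers M q G)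
    (h3 : 3 ≤ (B \ coloops M G).card) {z : α} (hz : z ∈ G \ clF M B) :
    (coverPreimages M (Uq M (q + 2) q) G (insert z B)).filter (fun B' => B' ∉ lay0 M q G) = {B} := by
  have hB' : B ∈ membersIn M (Uq M (q + 2) q) G := (mem_thinMembers.1 hB).1
  have hBU : B ∈ Uq M (q + 2) q := (mem_membersIn.1 hB').1
  have hzB : z ∉ B := notMem_of_notMem_clF hBU (Finset.mem_sdiff.1 hz).2
  ext B'
  rw [Finset.mem_filter, mem_coverPreimages, Finset.mem_singleton]
  constructor
  · rintro ⟨⟨hB'm, hcov⟩, hB'0⟩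
    obtain ⟨z', hz', hzz'⟩ := mem_coverSets.1 hcov
    have hB'U : B' ∈ Uq M (q + 2) q := (mem_membersIn.1 hB'm).1
    have hz'B' : z' ∉ B' := notMem_of_notMem_clF hB'U (Finset.mem_sdiff.1 hz').2
    have hB't : B' ∈ thinMembers M q G := mem_thinMembers.2 ⟨hB'm, hB'0⟩
    by_cases hzz : z' = z
    · -- insert z B' = insert z B with z ∉ B, B'
      subst hzz
      have h := congrArg (fun S => S.erase z') hzz'
      simp only [Finset.erase_insert hz'B', Finset.erase_insert hzB] at h
      exact h
    · -- z' ∈ B ∖ K and B' = insert z (B ∖ z'): not a member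
      exfalso
      have hz'B : z' ∈ B := by
        have : z' ∈ insert z B := by rw [← hzz']; exact Finset.mem_insert_self _ _
        rw [Finset.mem_insert] at this
        exact this.resolve_left hzz
      have hz'K : z' ∉ coloops M G := fun h => hz'B' (coloops_subset_of_mem_thinMembers hG hd hB't h)
      have hB'eq : B' = insert z (B.erase z') := by
        have h := congrArg (fun S => S.erase z') hzz'
        simp only [Finset.erase_insert hz'B'] at h
        rw [h, Finset.erase_insert_of_ne (Ne.symm hzz)]
      rw [hB'eq] at hB'U
      exact insert_erase_notMem_Uq hG hd hk hs hB h3 (Finset.mem_sdiff.2 ⟨hz'B, hz'K⟩) hz hB'U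
  · rintro rfl
    exact ⟨⟨hB', mem_coverSets.2 ⟨z, hz, rfl⟩⟩, (mem_thinMembers.1 hB).2⟩

open scoped Classical in
/-- Rigid cell: the layer-1 request at `B ∪ {z}` is `req B` when `|B ∖ K| ≥ 3`. -/
theorem L1_insert_eq_req_of_three_le {q : ℕ} {G : Finset α} (hG : G ∈ flatsQ M (q + 1))
    (hd : (gr M \ G).card ≤ q) (hk : kColoops M G + 2 = q)
    (hs : ∀ e ∈ gr M, ∀ f ∈ gr M, e ≠ f → rkN M {e, f} = 2) {B : Finset α} (hB : B ∈ thinMembers M q G)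
    (h3 : 3 ≤ (B \ coloops M G).card) {z : α} (hz : z ∈ G \ clF M B) :
    L1 M q G (insert z B) = req M q B := by
  unfold L1
  rw [coverPreimages_thin_eq_singleton hG hd hk hs hB h3 hz, Finset.sum_singleton]

/-- `Φ/(q+1) ≤ 1 − (q−2)Φ/q` for `q ≥ 2` (as rationals, with `k + 2 = q`). -/
theorem phiQ_div_le_cap_rigid {q k : ℕ} (hk : k + 2 = q) :
    phiQ q / ((q : ℚ) + 1) ≤ 1 - (k : ℚ) * phiQ q / (1 + ((q : ℚ) - 1)) := by
  subst hk
  unfold phiQ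
  push_cast
  have hk0 : (0 : ℚ) ≤ (k : ℚ) := by positivity
  have h3 : ((k : ℚ) + 2 + 1) ≠ 0 := by positivity
  have h2 : (1 : ℚ) + ((k : ℚ) + 2 - 1) ≠ 0 := by intro h; linarith
  rw [← sub_nonneg]
  have e : 1 - (k : ℚ) * (((k : ℚ) + 2 + 2) / ((k : ℚ) + 2 + 1)) / (1 + ((k : ℚ) + 2 - 1)) -
      ((k : ℚ) + 2 + 2) / ((k : ℚ) + 2 + 1) / ((k : ℚ) + 2 + 1) =
      (3 * (k : ℚ) + 10) / (((k : ℚ) + 3) ^ 2 * ((k : ℚ) + 2)) := by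
    field_simp
    ring
  rw [e]
  positivity

open scoped Classical in
/-- **Rigid cell: a thin member with `|B ∖ K| ≥ 3` loses nothing at any covering set.** -/
theorem loss_eq_zero_of_three_le {q : ℕ} {G : Finset α} (hG : G ∈ flatsQ M (q + 1))
    (hd : (gr M \ G).card = q - 1) (hk : kColoops M G + 2 = q)
    (hs : ∀ e ∈ gr M, ∀ f ∈ gr M, e ≠ f → rkN M {e, f} = 2) {B : Finset α} (hB : B ∈ thinMembers M q G)
    (h3 : 3 ≤ (B \ coloops M G).card) {z : α} (hz : z ∈ G \ clF M B) : loss M q G B z = 0 := by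
  have hd' : (gr M \ G).card ≤ q := by omega
  have hB' : B ∈ membersIn M (Uq M (q + 2) q) G := (mem_thinMembers.1 hB).1
  have hBU : B ∈ Uq M (q + 2) q := (mem_membersIn.1 hB').1
  have hBG : clF M B ⊆ G := (mem_membersIn.1 hB').2
  have hm := two_le_card_sdiff_of_not_lay0 hG hd' hB' (mem_thinMembers.1 hB).2
  have hSG : insert z B ⊆ G :=
    Finset.insert_subset (Finset.mem_sdiff.1 hz).1 ((subset_clF hBU).trans hBG)
  -- req B ≤ Φ/(q+1)
  have hreq : req M q B ≤ phiQ q / ((q : ℚ) + 1) := by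
    unfold req
    have hc : (q : ℚ) + 1 ≤ ((gr M \ clF M B).card : ℚ) := by
      rw [card_compl_clF_add hG hBG, hd]
      have : q + 1 ≤ (G \ clF M B).card + (q - 1) := by omega
      exact_mod_cast this
    exact div_le_div_of_nonneg_left (phiQ_pos q).le (by positivity) hc
  -- capS (B ∪ z) ≥ 1 − kΦ/(1+d)
  have hcap : 1 - (kColoops M G : ℚ) * phiQ q / (1 + ((q : ℚ) - 1)) ≤ capS M q G (insert z B) := by
    unfold capS
    have hk1 : (k1 M q G (insert z B) : ℚ) ≤ (kColoops M G : ℚ) := by exact_mod_cast k1_le_kColoops hSG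
    have hd1 : ((gr M \ G).card : ℚ) = (q : ℚ) - 1 := by
      rw [hd]; have : 1 ≤ q := by omega
      push_cast [Nat.cast_sub this]; ring
    rw [hd1]
    have hpos : (0 : ℚ) < 1 + ((q : ℚ) - 1) := by
      have : (1 : ℚ) ≤ (q : ℚ) := by exact_mod_cast (by omega : 1 ≤ q)
      linarith
    apply sub_le_sub_left
    apply div_le_div_of_nonneg_right _ hpos.le
    exact mul_le_mul_of_nonneg_right hk1 (phiQ_pos q).le
  have hL : L1 M q G (insert z B) ≤ capS M q G (insert z B) := by
    rw [L1_insert_eq_req_of_three_le hG hd' hk hs hB h3 hz]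
    exact hreq.trans ((phiQ_div_le_cap_rigid hk).trans hcap)
  unfold loss fS
  rw [if_pos hL]
  ring

end PercRepro.Shadow
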